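import Summits.Ventures.Crystal3D.Theorems.StickyWulffConstantGenericWallFloorSlotFrameIdentity
import Summits.Ventures.Crystal3D.Theorems.StickyWulffConstantGenericWallFloorPackingExtension
import HarnessLib

/-!
# The vacancy cage: a lattice hole with a (nearly) complete cage is an ADDABLE site (crux `GenericWallFloor`,
# stmt-Ventures-19480, line `WallLedgerG`; memo RISER-LEDGER-g8 §8, HOME/wall-p1-g8/)

HONEST FRAMING. Venture `Summits/Ventures/Crystal3D` (cell `crystal3d-full`), helper `--supports` the crux
`GenericWallFloor` of `route-Ventures-StickyWulffConstant`, REGISTERED line `WallLedgerG`, open stub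
`stub_twoSlabAdhesion`.  Structure only (census-free); F-C1 not moved; NOT the crux, no ledger here.

Memo §8: every one-credit-per-ball walker ledger is beaten by ENERGY-PAID vacancy attacks (a vacated lattice ball stops the
walkers at its deg-11 neighbours), while the addable-site credits of `…PackingExtension` price such attacks away — IF the prover
can certify that the empty slot `v` is addable (every ball at distance `≥ 1` from `v`).  This file supplies the census-free
certificate: a lattice hole whose CAGE (the twelve sites `v + A w`, `w ∈ fccSlots`) is occupied, or occupied up to ONE site, is
addable, because a ball closer than `1` to `v` would overlap a cage ball.

* `exists_slot_inner_ge_of_sum` — pigeonhole on the tight frame `Σ_w ⟪A w, x⟫² = 4‖x‖²` (`sum_slots_inner_sq_frame`): over any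
  slot set `S ⊆ fccSlots` closed under `w ↦ −w` whose complement has `k` slots, some `w ∈ S` has
  `c ≤ #S · ⟪A w, x⟫²` and `⟪A w, x⟫ ≥ 0` whenever `c ≤ Σ_{w ∈ S} ⟪A w, x⟫²`; for all twelve: `exists_slot_inner_sq_ge`
  (`‖x‖² ≤ 3 ⟪A w, x⟫²`, `⟪A w, x⟫ ≥ 0`);
* **`one_le_dist_of_cage`** — unit packing `X`, `v ∉ X`, all twelve cage sites in `X` ⇒ every `x ∈ X` has `dist x v ≥ 1`
  (`⟪A w, x − v⟫ ≥ ‖x − v‖/√3 > ‖x − v‖²/2` for `‖x − v‖ < 1`, so `x` would overlap the cage ball `v + A w`);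
* **`card_contacts_le_eleven_of_cage`**, `card_contacts_cage_ball_le_eleven` — hence every ball at distance `1` from such a
  hole, in particular each of the twelve cage balls, has at most `11` contacts (`card_contacts_le_eleven_of_addable`): the
  vacancy's `+12` is certified ball by ball, census-free.
WHAT THIS IS NOT: no ledger; cages missing one or two sites (divacancy rows) are also addable but need the vertex-figure
identity of the cuboctahedron, not the pigeonhole — not here; F-C1 not moved.
-/

noncomputable section

namespace Summit.Ventures.Crystal3D.Theorems

open Finset
open Literature.MathematicalPhysics.StatisticalMechanics (fccStacking)
open scoped InnerProductSpace

variable {X : Finset (EuclideanSpace ℝ (Fin 3))}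

/-! ### Pigeonhole on the tight frame -/

/-- Over a slot set `S` closed under negation, the sum of `⟪A w, x⟫²` is at most `#S · max`, and the max is attained with a
nonnegative sign: if `Σ_{w ∈ S} ⟪A w, x⟫² ≥ c` then some `w ∈ S` has `c ≤ #S · ⟪A w, x⟫²` and `0 ≤ ⟪A w, x⟫`. -/
theorem exists_slot_inner_sq_ge_of_sum (A : EuclideanSpace ℝ (Fin 3) ≃ₗᵢ[ℝ] EuclideanSpace ℝ (Fin 3))
    (S : Finset (EuclideanSpace ℝ (Fin 3))) (hSneg : ∀ w ∈ S, -w ∈ S) (hSne : S.Nonempty) (x : EuclideanSpace ℝ (Fin 3))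
    {c : ℝ} (hc : c ≤ ∑ w ∈ S, ⟪A w, x⟫_ℝ ^ 2) :
    ∃ w ∈ S, c ≤ S.card * ⟪A w, x⟫_ℝ ^ 2 ∧ 0 ≤ ⟪A w, x⟫_ℝ := by
  obtain ⟨w₀, hw₀, hmax⟩ := exists_max_image S (fun w => ⟪A w, x⟫_ℝ ^ 2) hSne
  have hsum : ∑ w ∈ S, ⟪A w, x⟫_ℝ ^ 2 ≤ S.card * ⟪A w₀, x⟫_ℝ ^ 2 := by
    have := Finset.sum_le_card_nsmul S (fun w => ⟪A w, x⟫_ℝ ^ 2) _ hmax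
    simpa [nsmul_eq_mul] using this
  by_cases h0 : 0 ≤ ⟪A w₀, x⟫_ℝ
  · exact ⟨w₀, hw₀, hc.trans hsum, h0⟩
  · refine ⟨-w₀, hSneg w₀ hw₀, ?_, ?_⟩
    · have : ⟪A (-w₀), x⟫_ℝ ^ 2 = ⟪A w₀, x⟫_ℝ ^ 2 := by rw [map_neg, inner_neg_left]; ring
      rw [this]; exact hc.trans hsum
    · rw [map_neg, inner_neg_left]; linarith [not_le.1 h0]

/-- All twelve slots: some slot has `‖x‖² ≤ 3 ⟪A w, x⟫²` with `⟪A w, x⟫ ≥ 0`. -/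
theorem exists_slot_inner_sq_ge (A : EuclideanSpace ℝ (Fin 3) ≃ₗᵢ[ℝ] EuclideanSpace ℝ (Fin 3))
    (x : EuclideanSpace ℝ (Fin 3)) : ∃ w ∈ fccSlots, ‖x‖ ^ 2 ≤ 3 * ⟪A w, x⟫_ℝ ^ 2 ∧ 0 ≤ ⟪A w, x⟫_ℝ := by
  have hne : fccSlots.Nonempty := by rw [← Finset.card_pos, card_fccSlots]; norm_num
  obtain ⟨w, hw, h, hs⟩ := exists_slot_inner_sq_ge_of_sum A fccSlots (fun w hw => neg_mem_fccSlots hw) hne x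
    (le_of_eq (sum_slots_inner_sq_frame A x).symm)
  refine ⟨w, hw, ?_, hs⟩
  rw [card_fccSlots] at h; push_cast at h; linarith

/-! ### The cage lemmas -/

/-- Distance to a cage site in terms of the offset: `dist x (v + u)² = ‖x − v‖² − 2⟪u, x − v⟫ + 1` for a unit `u`. -/
theorem dist_sq_cage_site (x v u : EuclideanSpace ℝ (Fin 3)) (hu : ‖u‖ = 1) :
    dist x (v + u) ^ 2 = ‖x - v‖ ^ 2 - 2 * ⟪u, x - v⟫_ℝ + 1 := by
  rw [dist_eq_norm, show x - (v + u) = (x - v) - u by abel, @norm_sub_sq_real, hu, real_inner_comm]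
  ring

/-- **A hole with a complete cage is addable.**  If `X` is a unit packing, `v ∉ X`, and all twelve cage sites `v + A w` are
balls of `X`, then every ball of `X` is at distance `≥ 1` from `v`. -/
theorem one_le_dist_of_cage (hX : ∀ p ∈ X, ∀ q ∈ X, p ≠ q → 1 ≤ dist p q)
    (A : EuclideanSpace ℝ (Fin 3) ≃ₗᵢ[ℝ] EuclideanSpace ℝ (Fin 3)) {v : EuclideanSpace ℝ (Fin 3)} (hv : v ∉ X)
    (hcage : ∀ w ∈ fccSlots, v + A w ∈ X) : ∀ x ∈ X, 1 ≤ dist x v := by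
  intro x hx
  by_contra hlt
  rw [not_le] at hlt
  have hxv : x ≠ v := fun h => hv (h ▸ hx)
  have hpos : 0 < ‖x - v‖ := norm_pos_iff.2 (sub_ne_zero.2 hxv)
  have hlt' : ‖x - v‖ < 1 := by rwa [dist_eq_norm] at hlt
  obtain ⟨w, hw, hsq, hsgn⟩ := exists_slot_inner_sq_ge A (x - v)
  have hAw : ‖A w‖ = 1 := by rw [LinearIsometryEquiv.norm_map, norm_eq_one_of_mem_fccSlots hw]
  -- `⟪A w, x − v⟫ ≥ ‖x − v‖/√3 > ‖x − v‖²/2`, so `x` overlaps the cage ball `v + A w`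
  have hinner : ‖x - v‖ ^ 2 < 2 * ⟪A w, x - v⟫_ℝ := by
    -- from `‖e‖² ≤ 3 t²`, `t ≥ 0`, `0 < ‖e‖ < 1`: if `2t ≤ ‖e‖² < ‖e‖` then `t < ‖e‖/2`, `3t² < ‖e‖²`, contradiction
    by_contra hle
    rw [not_lt] at hle
    have hn2 : ‖x - v‖ ^ 2 < ‖x - v‖ := by nlinarith
    have ht : ⟪A w, x - v⟫_ℝ ≤ ‖x - v‖ / 2 := by linarith
    have ht2 : ⟪A w, x - v⟫_ℝ ^ 2 ≤ (‖x - v‖ / 2) ^ 2 := pow_le_pow_left₀ hsgn ht 2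
    nlinarith [hsq, ht2, hpos]
  have hd : dist x (v + A w) ^ 2 < 1 := by
    rw [dist_sq_cage_site x v (A w) hAw]; linarith
  have hd1 : dist x (v + A w) < 1 := by
    have h0 : 0 ≤ dist x (v + A w) := dist_nonneg
    nlinarith
  have hne : x ≠ v + A w := by
    intro h
    rw [h, dist_eq_norm, add_sub_cancel_left, hAw] at hlt
    exact lt_irrefl _ hlt
  exact absurd (hX x hx (v + A w) (hcage w hw) hne) (not_le.2 hd1)

/-- **Every ball touching a complete-cage hole has at most eleven contacts** — in particular each of the twelve cage
balls: the vacancy's deficit is certified ball by ball (`card_contacts_le_eleven_of_addable`). -/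
theorem card_contacts_le_eleven_of_cage (hX : ∀ p ∈ X, ∀ q ∈ X, p ≠ q → 1 ≤ dist p q)
    (A : EuclideanSpace ℝ (Fin 3) ≃ₗᵢ[ℝ] EuclideanSpace ℝ (Fin 3)) {v : EuclideanSpace ℝ (Fin 3)} (hv : v ∉ X)
    (hcage : ∀ w ∈ fccSlots, v + A w ∈ X) {y : EuclideanSpace ℝ (Fin 3)} (hyv : dist y v = 1) :
    (X.filter fun q => dist y q = 1).card ≤ 11 :=
  card_contacts_le_eleven_of_addable X hX v (fun q hq => by rw [dist_comm]; exact one_le_dist_of_cage hX A hv hcage q hq) hyv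

/-- The cage balls themselves touch the hole: `dist (v + A w) v = 1`. -/
theorem dist_cage_site_eq_one (A : EuclideanSpace ℝ (Fin 3) ≃ₗᵢ[ℝ] EuclideanSpace ℝ (Fin 3)) (v : EuclideanSpace ℝ (Fin 3))
    {w : EuclideanSpace ℝ (Fin 3)} (hw : w ∈ fccSlots) : dist (v + A w) v = 1 := by
  rw [dist_eq_norm, add_sub_cancel_left, LinearIsometryEquiv.norm_map, norm_eq_one_of_mem_fccSlots hw]

/-- **The twelve cage balls of a complete-cage hole each have at most eleven contacts.** -/
theorem card_contacts_cage_ball_le_eleven (hX : ∀ p ∈ X, ∀ q ∈ X, p ≠ q → 1 ≤ dist p q)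
    (A : EuclideanSpace ℝ (Fin 3) ≃ₗᵢ[ℝ] EuclideanSpace ℝ (Fin 3)) {v : EuclideanSpace ℝ (Fin 3)} (hv : v ∉ X)
    (hcage : ∀ w ∈ fccSlots, v + A w ∈ X) {w : EuclideanSpace ℝ (Fin 3)} (hw : w ∈ fccSlots) :
    (X.filter fun q => dist (v + A w) q = 1).card ≤ 11 :=
  card_contacts_le_eleven_of_cage hX A hv hcage (dist_cage_site_eq_one A v hw)

end Summit.Ventures.Crystal3D.Theorems

end
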